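import Summits.AtomisticToContinuum.FouriersLaw.Theses.CurrentTiltQuench

/-!
# `CurrentTiltQuench.FluctuationStateDichotomy` (stmt-AtomisticToContinuum-11031) — proved

The by-product theorem of route CurrentTiltQuench, typed WITH its two antecedents: `UniformQuadraticResponse → QuenchCurrentDies →`
(for a symmetric set-up and a clip level `M > 0`, if the truncated Drude weight does NOT vanish — some `η > 0` is exceeded by
`|A_M(L,τ)|` for unboundedly many `τ` and, given `τ`, unboundedly many `L` — then there is a shift-invariant, time-invariant, REGULAR
probability measure of the infinite pinned chain with non-zero mean clipped current).

Pure logic: if NO such state existed, every shift-invariant time-invariant regular probability measure would give zero mean to the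
clipped current, which is exactly the rigidity premise of `QuenchCurrentDies` at this `(M, F)`; the bridge arithmetic of `BridgeGlue`
(`ε = min(ε₀, η/(2(|K|+1)))`, `δ = εη/2`, `|εX| ≤ |Y − εX| + |Y|`) then bounds `|A_M(L,τ)| ≤ η` for all large `τ` and `L`, contradicting the
hypothesis. Landed by lead c4 of crux stmt-9127 (whose open core is `NoTruncatedDrude`, stmt-11030): read contrapositively it says what a
REFUTATION of stmt-9127's open core must produce. No definitions.
-/

namespace Summit.AtomisticToContinuum.FouriersLaw.Theorems.CurrentTiltQuench

open Summit.AtomisticToContinuum.FouriersLaw.Theses.CurrentTiltQuench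

/-- **`FluctuationStateDichotomy` (stmt-AtomisticToContinuum-11031).** Given `UniformQuadraticResponse` and `QuenchCurrentDies`: for a
symmetric set-up `(μ_T, D)` of `pinnedChain ω₂ lam β γ` (`ω₂, lam, β > 0`, `T > 0`) and `M > 0`, a non-vanishing truncated Drude weight
(`∃ η > 0`, for unboundedly many `τ` and then unboundedly many `L`, `η < |A_M(L,τ)|`) yields a shift-invariant, time-invariant, regular
probability measure `ν` with `∫ F_M(j_0) dν ≠ 0`. [folklore] -/
theorem fluctuationStateDichotomy_proof :
    Summit.AtomisticToContinuum.FouriersLaw.Theses.CurrentTiltQuench.FluctuationStateDichotomy := by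
  intro hU hQ ω₂ lam β γ hω hl hβ T hT μ hGibbs hS hR D hPres hCov M hM F hF hpos
  by_contra hcon
  push Not at hcon
  -- the rigidity premise of `QuenchCurrentDies` at `(M, F)` holds since no current-carrying state exists
  have hrig : ∀ ν : MeasureTheory.Measure Literature.MathematicalPhysics.KineticTheory.HeatConduction.ChainConfig,
      MeasureTheory.IsProbabilityMeasure ν → Literature.MathematicalPhysics.KineticTheory.HeatConduction.IsShiftInvariant ν →
      Literature.MathematicalPhysics.KineticTheory.HeatConduction.IsTimeInvariant (Literature.MathematicalPhysics.KineticTheory.HeatConduction.pinnedChain ω₂ lam β γ) ν →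
      Literature.MathematicalPhysics.KineticTheory.HeatConduction.IsRegular (Literature.MathematicalPhysics.KineticTheory.HeatConduction.pinnedChain ω₂ lam β γ) ν →
      ∫ σ, F ((Literature.MathematicalPhysics.KineticTheory.HeatConduction.pinnedChain ω₂ lam β γ).bondCurrentZ σ 0) ∂ν = 0 :=
    fun ν h1 h2 h3 h4 => hcon ν h1 h2 h3 h4
  obtain ⟨η, hη, hbad⟩ := hpos
  obtain ⟨ε₀, hε₀, K, hK⟩ := hU ω₂ lam β γ hω hl hβ T hT μ hGibbs hS hR D hPres hCov M hM F hF
  set ε : ℝ := min ε₀ (η / (2 * (|K| + 1))) with hεdef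
  have hKpos : 0 < |K| + 1 := by positivity
  have hεpos : 0 < ε := lt_min hε₀ (by positivity)
  have hεle : ε ≤ ε₀ := min_le_left _ _
  have hεle' : ε ≤ η / (2 * (|K| + 1)) := min_le_right _ _
  obtain ⟨τ₀, hτ₀⟩ := hQ ω₂ lam β γ hω hl hβ T hT μ hGibbs hS hR D hPres hCov M hM F hF hrig ε hεpos (ε * η / 2)
    (by positivity)
  -- a bad `τ ≥ max τ₀ 1` and then a bad `L ≥ max L₁ L₂`
  obtain ⟨τ, hτ, hbadL⟩ := hbad (max τ₀ 1)
  obtain ⟨L₁, hL₁⟩ := hτ₀ τ (le_of_max_le_left hτ)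
  obtain ⟨L₂, hL₂⟩ := hK ε hεpos hεle τ (le_of_max_le_right hτ)
  obtain ⟨L, hL, hbadG⟩ := hbadL (max L₁ L₂)
  have h1 := hL₁ L (le_of_max_le_left hL) _ rfl
  have h2 := hL₂ L (le_of_max_le_right hL) _ rfl
  have h0 := hbadG _ rfl
  generalize hX : (τ⁻¹ * ∫ t in (0:ℝ)..τ, ((∫ σ, F ((Literature.MathematicalPhysics.KineticTheory.HeatConduction.pinnedChain ω₂ lam β γ).bondCurrentZ (D.flow t σ) 0) * (fun σ : Literature.MathematicalPhysics.KineticTheory.HeatConduction.ChainConfig => ∑ x ∈ Finset.Icc (-(L : ℤ)) (L : ℤ), F ((Literature.MathematicalPhysics.KineticTheory.HeatConduction.pinnedChain ω₂ lam β γ).bondCurrentZ σ x)) σ ∂μ) - (∫ σ, F ((Literature.MathematicalPhysics.KineticTheory.HeatConduction.pinnedChain ω₂ lam β γ).bondCurrentZ (D.flow t σ) 0) ∂μ) * (∫ σ, (fun σ : Literature.MathematicalPhysics.KineticTheory.HeatConduction.ChainConfig => ∑ x ∈ Finset.Icc (-(L : ℤ)) (L : ℤ), F ((Literature.MathematicalPhysics.KineticTheory.HeatConduction.pinnedChain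 ω₂ lam β γ).bondCurrentZ σ x)) σ ∂μ))) = X at h2 h0
  generalize hYY : (τ⁻¹ * ∫ t in (0:ℝ)..τ, ((∫ σ, F ((Literature.MathematicalPhysics.KineticTheory.HeatConduction.pinnedChain ω₂ lam β γ).bondCurrentZ (D.flow t σ) 0) * Real.exp (ε * (fun σ : Literature.MathematicalPhysics.KineticTheory.HeatConduction.ChainConfig => ∑ x ∈ Finset.Icc (-(L : ℤ)) (L : ℤ), F ((Literature.MathematicalPhysics.KineticTheory.HeatConduction.pinnedChain ω₂ lam β γ).bondCurrentZ σ x)) σ) ∂μ) / (∫ σ, Real.exp (ε * (fun σ : Literature.MathematicalPhysics.KineticTheory.HeatConduction.ChainConfig => ∑ x ∈ Finset.Icc (-(L : ℤ)) (L : ℤ), F ((Literature.MathematicalPhysics.KineticTheory.HeatConduction.pinnedChain ω₂ lam β γ).bondCurrentZ σ x)) σ) ∂μ) - ∫ σ, F ((Literature.MathematicalPhysics.KineticTheory.HeatConduction.pinnedChain ω₂ lam β γ).bondCurrentZ (D.flow t σ) 0) ∂μ)) = Y at h1 h2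
  have h3 : ε * |X| ≤ K * ε ^ 2 + ε * η / 2 := by
    have : |ε * X| ≤ |Y - ε * X| + |Y| := by
      calc |ε * X| = |Y - (Y - ε * X)| := by ring_nf
        _ ≤ |Y| + |Y - ε * X| := abs_sub _ _
        _ = |Y - ε * X| + |Y| := by ring
    rw [abs_mul, abs_of_pos hεpos] at this
    linarith
  have h4 : |X| ≤ K * ε + η / 2 := by
    have h3' : ε * |X| ≤ ε * (K * ε + η / 2) := by
      calc ε * |X| ≤ K * ε ^ 2 + ε * η / 2 := h3
        _ = ε * (K * ε + η / 2) := by ring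
    exact le_of_mul_le_mul_left h3' hεpos
  have h5 : K * ε ≤ η / 2 := by
    have hK1 : K * ε ≤ |K| * (η / (2 * (|K| + 1))) :=
      (mul_le_mul_of_nonneg_right (le_abs_self K) hεpos.le).trans (mul_le_mul_of_nonneg_left hεle' (abs_nonneg K))
    have hK2 : |K| * (η / (2 * (|K| + 1))) ≤ η / 2 := by
      rw [← mul_div_assoc, div_le_iff₀ (by positivity : (0:ℝ) < 2 * (|K| + 1))]
      have : η / 2 * (2 * (|K| + 1)) = |K| * η + η := by ring
      rw [this]
      linarith
    linarith
  linarith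

end Summit.AtomisticToContinuum.FouriersLaw.Theorems.CurrentTiltQuench
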